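import Literature.MathematicalPhysics.QuantumFieldTheory.GaussianToolkit
import Mathlib.Probability.Distributions.Gaussian.Multivariate
import Mathlib.MeasureTheory.Group.Integral
import HarnessLib

/-!
# Gaussian integrals of a positive definite form with a linear phase, and over an injective
# linear image (the spin-wave factor `e^{-‖P_E σ‖²/2β}`)

Support file for the duality transformation of four-dimensional `U(1)` lattice gauge theory
(proof programme of the named fact
`Literature.MathematicalPhysics.QuantumFieldTheory.FrohlichSpencerU1PerimeterLawD4` and of its
corollary `Literature.Barriers.QuantumFields.AbelianDeconfinementD4`): after unfolding the Villain
angles to real variables `φ` on the gauge-fixed links (`PeriodicUnfolding`), the `φ`-integral is a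
Gaussian integral of the form `∫ e^{-(β/2)‖Tφ + w‖² + i⟨Tφ + w, σ⟩} dφ` with `T = d` (restricted to
the free links) INJECTIVE, `w = 2πn` the integer flux and `σ` the sheet of the Wilson loop; its value
factors into the `w`-independent normalisation, the Coulomb weight `e^{-(β/2)‖w_⊥‖²}` of the
component of `w` orthogonal to the exact forms `E = range T`, the phase `e^{i⟨w_⊥, σ⟩}`, and the
SPIN-WAVE factor `e^{-⟨σ, P_E σ⟩/(2β)}` (FS82 (2.52)–(2.54): `e^{-(1/2β)(ε_Λ, ε_Λ)}` in the dual
language; (2.33): the Gaussian characteristic function `∫ e^{iα(μ)} dμ⁰ = e^{-(β/2)(μ, V_Λ μ)}`).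
Everything is proved; no named fact is introduced.

* `integral_exp_quadratic_mul_cexp` (**characteristic function of the weight `e^{-½ xᵀPx}`**): for
  positive definite `P`, `∫ e^{-½xᵀPx} e^{i ξ·x} dx = Z_P e^{-½ ξᵀP⁻¹ξ}` with
  `Z_P = ∫ e^{-½xᵀPx} dx ∈ (0, ∞)` (`integral_exp_quadratic`, `integrable_exp_quadratic`; from
  Mathlib's `charFun_multivariateGaussian` and the density of `GaussianToolkit`);
* `exact_part`/`perp_part` (`P_E w = T M⁻¹ Tᵀ w`, `w_⊥ = w - P_E w`, `M = TᵀT`), with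
  `transpose_mulVec_perp_part : Tᵀ w_⊥ = 0` and the Pythagorean splitting;
* `integral_exp_quadratic_linear_image` (**the Gaussian integral over an injective linear image**):
  `∫ e^{-(β/2)‖Tφ+w‖²} e^{i⟨Tφ+w,σ⟩} dφ = Z_{βM} e^{-(β/2)‖w_⊥‖²} e^{i⟨w_⊥,σ⟩} e^{-(Tᵀσ)ᵀM⁻¹(Tᵀσ)/(2β)}`.

## References

* J. Fröhlich, T. Spencer, Comm. Math. Phys. 83 (1982) 411–454, §2.5 (2.32)–(2.36), §2.7
  (2.52)–(2.54). [FrohlichSpencerCMP1982]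
-/

noncomputable section

open MeasureTheory Complex Matrix WithLp ProbabilityTheory
open scoped RealInnerProductSpace ENNReal Real
open Literature.MathematicalPhysics.QuantumFieldTheory.GaussianToolkit

namespace Literature.Probability.LatticeModels

namespace GaussianCoord

variable {ι : Type*} [Fintype ι] [DecidableEq ι]

/-! ### The characteristic function of the weight `e^{-½ xᵀ P x}` -/

/-- On Euclidean `ℝ^ι`: `∫ w_P(y) e^{i⟪y,ξ⟫} dy = Z_P e^{-½ ξᵀP⁻¹ξ}` for positive definite `P`
(Mathlib's `charFun_multivariateGaussian` for `N(0, P⁻¹) = Z_P⁻¹ w_P dy`). [folklore] -/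
theorem integral_gaussWeight_toReal_smul_cexp (P : Matrix ι ι ℝ) (hP : P.PosDef)
    (ξ : EuclideanSpace ℝ ι) :
    ∫ y, (gaussWeight P y).toReal • cexp (⟪y, ξ⟫ * I) =
      ((gaussZ P).toReal : ℂ) * cexp (-((ofLp ξ ⬝ᵥ P⁻¹ *ᵥ ofLp ξ : ℝ) : ℂ) / 2) := by
  obtain ⟨hμ, hZ0, hZtop⟩ := multivariateGaussian_inv_eq_withDensity hP
  have hchar := charFun_multivariateGaussian (μ := 0) hP.inv.posSemidef ξ
  rw [charFun, hμ, integral_smul_measure,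
    integral_withDensity_eq_integral_toReal_smul (measurable_gaussWeight P)
      (Filter.Eventually.of_forall fun y => ENNReal.ofReal_lt_top), inner_zero_right] at hchar
  have hZr : (gaussZ P).toReal ≠ 0 := ENNReal.toReal_ne_zero.2 ⟨hZ0, hZtop⟩
  have hcoef : ((gaussZ P)⁻¹).toReal = (gaussZ P).toReal⁻¹ := ENNReal.toReal_inv _
  rw [hcoef] at hchar
  have key : ∫ y, (gaussWeight P y).toReal • cexp (⟪y, ξ⟫ * I) =
      (gaussZ P).toReal • cexp (((0 : ℝ) : ℂ) * I - (ofLp ξ ⬝ᵥ P⁻¹ *ᵥ ofLp ξ : ℝ) / 2) := by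
    rw [← hchar, smul_smul, mul_inv_cancel₀ hZr, one_smul]
  rw [key, Complex.real_smul]
  congr 1
  push_cast
  ring_nf

/-- **The characteristic function of `e^{-½ xᵀPx}` on `ℝ^ι`**: for positive definite `P` and
`ξ ∈ ℝ^ι`, `∫ e^{-½ xᵀPx} e^{i ξ·x} dx = Z_P e^{-½ ξᵀP⁻¹ξ}`, `Z_P = gaussZ P` (FS82 (2.33):
`∫ e^{iα(μ)} dμ⁰_Λ(α) = e^{-(β/2)(μ, V_Λ μ)}`, `V_Λ` the covariance).
[cite: FrohlichSpencerCMP1982, §2.5 (2.32)–(2.33) p. 423] -/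
theorem integral_exp_quadratic_mul_cexp (P : Matrix ι ι ℝ) (hP : P.PosDef) (ξ : ι → ℝ) :
    ∫ x : ι → ℝ, (Real.exp (-(x ⬝ᵥ P *ᵥ x) / 2) : ℂ) * cexp (I * (ξ ⬝ᵥ x : ℝ)) =
      ((gaussZ P).toReal : ℂ) * cexp (-((ξ ⬝ᵥ P⁻¹ *ᵥ ξ : ℝ) : ℂ) / 2) := by
  have h := integral_gaussWeight_toReal_smul_cexp P hP (toLp 2 ξ)
  rw [← (EuclideanSpace.volume_preserving_symm_measurableEquiv_toLp ι).integral_comp']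
  simp only [MeasurableEquiv.coe_toLp_symm]
  rw [← h]
  refine integral_congr_ae (Filter.Eventually.of_forall fun y => ?_)
  simp only [gaussWeight, EuclideanSpace.inner_eq_star_dotProduct, star_trivial, Complex.real_smul]
  rw [ENNReal.toReal_ofReal (Real.exp_nonneg _)]
  congr 1
  ring_nf

omit [DecidableEq ι] in
/-- `Z_P = ∫ e^{-½ xᵀPx} dx` over `ℝ^ι`. [folklore] -/
theorem integral_exp_quadratic (P : Matrix ι ι ℝ) :
    ∫ x : ι → ℝ, Real.exp (-(x ⬝ᵥ P *ᵥ x) / 2) = (gaussZ P).toReal := by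
  rw [← (EuclideanSpace.volume_preserving_symm_measurableEquiv_toLp ι).integral_comp']
  simp only [MeasurableEquiv.coe_toLp_symm]
  rw [gaussZ, integral_eq_lintegral_of_nonneg_ae (Filter.Eventually.of_forall fun y => Real.exp_nonneg _)
    ((measurable_gaussWeight P).ennreal_toReal.aestronglyMeasurable.congr ?_)]
  · rfl
  · exact Filter.Eventually.of_forall fun y => by
      simp [gaussWeight, ENNReal.toReal_ofReal (Real.exp_nonneg _)]

/-- `0 < Z_P < ∞` for positive definite `P`. [folklore] -/
theorem gaussZ_toReal_pos (P : Matrix ι ι ℝ) (hP : P.PosDef) : 0 < (gaussZ P).toReal := by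
  obtain ⟨-, hZ0, hZtop⟩ := multivariateGaussian_inv_eq_withDensity hP
  exact ENNReal.toReal_pos hZ0 hZtop

/-- `x ↦ e^{-½ xᵀPx}` is integrable on `ℝ^ι` for positive definite `P`. [folklore] -/
theorem integrable_exp_quadratic (P : Matrix ι ι ℝ) (hP : P.PosDef) :
    Integrable fun x : ι → ℝ => Real.exp (-(x ⬝ᵥ P *ᵥ x) / 2) := by
  obtain ⟨-, -, hZtop⟩ := multivariateGaussian_inv_eq_withDensity hP
  have h1 : Integrable (fun y : EuclideanSpace ℝ ι => (gaussWeight P y).toReal) :=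
    integrable_toReal_of_lintegral_ne_top (measurable_gaussWeight P).aemeasurable hZtop
  refine ((EuclideanSpace.volume_preserving_symm_measurableEquiv_toLp ι).integrable_comp_emb
    (MeasurableEquiv.measurableEmbedding _)).1 ?_
  refine h1.congr (Filter.Eventually.of_forall fun y => ?_)
  simp [MeasurableEquiv.coe_toLp_symm, gaussWeight, ENNReal.toReal_ofReal (Real.exp_nonneg _)]

/-! ### The Gaussian integral over an injective linear image -/

section LinearImage

variable {κ : Type*} [Fintype κ]

/-- The Gram matrix `M = TᵀT` of the linear map `T : ℝ^ι → ℝ^κ` (positive definite iff `T` is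
injective, `Matrix.PosDef.conjTranspose_mul_self`). [folklore] -/
def gram (T : Matrix κ ι ℝ) : Matrix ι ι ℝ := Tᵀ * T

/-- The exact (range-`T`) part `P_E w = T M⁻¹ Tᵀ w` of `w ∈ ℝ^κ`. [cite: FrohlichSpencerCMP1982, (2.50)–(2.51) (`dτ`, the exact part of the sheet)] -/
def exactPart (T : Matrix κ ι ℝ) (w : κ → ℝ) : κ → ℝ := T *ᵥ ((gram T)⁻¹ *ᵥ (Tᵀ *ᵥ w))

/-- The orthogonal part `w_⊥ = w - P_E w`. [cite: FrohlichSpencerCMP1982, (2.51) (`ε_Λ = σ - dτ`)] -/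
def perpPart (T : Matrix κ ι ℝ) (w : κ → ℝ) : κ → ℝ := w - exactPart T w

/-- The preimage `φ_w = M⁻¹ Tᵀ w` with `T φ_w = P_E w`. [folklore] -/
def exactPreimage (T : Matrix κ ι ℝ) (w : κ → ℝ) : ι → ℝ := (gram T)⁻¹ *ᵥ (Tᵀ *ᵥ w)

/-- The spin-wave energy `E_T(σ) = (Tᵀσ)ᵀ M⁻¹ (Tᵀσ) = ⟨σ, P_E σ⟩`.
[cite: FrohlichSpencerCMP1982, (2.88) (`(ε_Λ, ε_Λ)`, in the dual language)] -/
def exactEnergy (T : Matrix κ ι ℝ) (σ : κ → ℝ) : ℝ := (Tᵀ *ᵥ σ) ⬝ᵥ ((gram T)⁻¹ *ᵥ (Tᵀ *ᵥ σ))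

omit [DecidableEq ι] in
/-- `(T v) · u = v · (Tᵀ u)`. [folklore] -/
theorem mulVec_dotProduct_eq (T : Matrix κ ι ℝ) (v : ι → ℝ) (u : κ → ℝ) :
    (T *ᵥ v) ⬝ᵥ u = v ⬝ᵥ (Tᵀ *ᵥ u) := by
  rw [dotProduct_comm, dotProduct_mulVec, Matrix.mulVec_transpose, dotProduct_comm]

/-- `Tᵀ w_⊥ = 0`: the orthogonal part is orthogonal to the range of `T`. [folklore] -/
theorem transpose_mulVec_perpPart (T : Matrix κ ι ℝ) (hM : (gram T).PosDef) (w : κ → ℝ) :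
    Tᵀ *ᵥ perpPart T w = 0 := by
  have hdet : IsUnit (gram T).det := (Matrix.isUnit_iff_isUnit_det _).1 hM.isUnit
  rw [perpPart, exactPart, Matrix.mulVec_sub, Matrix.mulVec_mulVec, ← gram, Matrix.mulVec_mulVec,
    Matrix.mul_nonsing_inv _ hdet, Matrix.one_mulVec, sub_self]

/-- `(T φ) · w_⊥ = 0`. [folklore] -/
theorem mulVec_dotProduct_perpPart (T : Matrix κ ι ℝ) (hM : (gram T).PosDef) (w : κ → ℝ)
    (φ : ι → ℝ) : (T *ᵥ φ) ⬝ᵥ perpPart T w = 0 := by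
  rw [mulVec_dotProduct_eq, transpose_mulVec_perpPart T hM, dotProduct_zero]

/-- Shifting by `φ_w`: `T(ψ - φ_w) + w = Tψ + w_⊥`. [folklore] -/
theorem mulVec_sub_exactPreimage_add (T : Matrix κ ι ℝ) (w : κ → ℝ) (ψ : ι → ℝ) :
    T *ᵥ (ψ - exactPreimage T w) + w = T *ᵥ ψ + perpPart T w := by
  rw [Matrix.mulVec_sub, perpPart, exactPart, exactPreimage]
  abel

omit [DecidableEq ι] in
/-- `‖Tψ‖² = ψᵀ M ψ`. [folklore] -/
theorem mulVec_dotProduct_self (T : Matrix κ ι ℝ) (ψ : ι → ℝ) :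
    (T *ᵥ ψ) ⬝ᵥ (T *ᵥ ψ) = ψ ⬝ᵥ (gram T *ᵥ ψ) := by
  rw [mulVec_dotProduct_eq, gram, ← Matrix.mulVec_mulVec]

/-- The Pythagorean splitting `‖Tψ + w_⊥‖² = ψᵀMψ + ‖w_⊥‖²`. [folklore] -/
theorem norm_sq_mulVec_add_perpPart (T : Matrix κ ι ℝ) (hM : (gram T).PosDef) (w : κ → ℝ)
    (ψ : ι → ℝ) :
    (T *ᵥ ψ + perpPart T w) ⬝ᵥ (T *ᵥ ψ + perpPart T w) =
      ψ ⬝ᵥ (gram T *ᵥ ψ) + perpPart T w ⬝ᵥ perpPart T w := by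
  rw [add_dotProduct, dotProduct_add, dotProduct_add, mulVec_dotProduct_self,
    mulVec_dotProduct_perpPart T hM, dotProduct_comm (perpPart T w) (T *ᵥ ψ),
    mulVec_dotProduct_perpPart T hM]
  ring

/-- `(β M)⁻¹ = β⁻¹ M⁻¹`. [folklore] -/
theorem inv_smul_gram (T : Matrix κ ι ℝ) (hM : (gram T).PosDef) {β : ℝ} (hβ : β ≠ 0) :
    (β • gram T)⁻¹ = β⁻¹ • (gram T)⁻¹ := by
  have hdet : IsUnit (gram T).det := (Matrix.isUnit_iff_isUnit_det _).1 hM.isUnit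
  refine Matrix.inv_eq_left_inv ?_
  rw [Matrix.smul_mul, Matrix.mul_smul, smul_smul, inv_mul_cancel₀ hβ, one_smul,
    Matrix.nonsing_inv_mul _ hdet]

/-- **The Gaussian integral over an injective linear image** (the spin-wave factorisation): for
`T : ℝ^ι → ℝ^κ` with positive definite Gram matrix `M = TᵀT`, `β > 0`, and `w, σ ∈ ℝ^κ`,
`∫ e^{-(β/2)‖Tφ + w‖²} e^{i(Tφ + w)·σ} dφ
   = Z_{βM} · e^{-(β/2)‖w_⊥‖²} · e^{i w_⊥·σ} · e^{-E_T(σ)/(2β)}`,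
with `w_⊥ = w - P_E w` the part of `w` orthogonal to the range of `T`, `E_T(σ) = (Tᵀσ)ᵀM⁻¹(Tᵀσ)`
the spin-wave energy and `Z_{βM} = ∫ e^{-(β/2)‖Tφ‖²} dφ` (shift `φ ↦ φ - M⁻¹Tᵀw`, Pythagoras, and
`integral_exp_quadratic_mul_cexp`). In FS82's duality this is (2.52)–(2.54) with (2.33): the
translation `α → α + τ` produces `e^{-(1/2β)(ε_Λ,ε_Λ)}` times a phase times the Gaussian
characteristic function. [cite: FrohlichSpencerCMP1982, §2.5 (2.33), §2.7 (2.52)–(2.54) pp. 423, 427] -/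
theorem integral_exp_quadratic_linear_image (T : Matrix κ ι ℝ) (hM : (gram T).PosDef) {β : ℝ}
    (hβ : 0 < β) (w σ : κ → ℝ) :
    ∫ φ : ι → ℝ, (Real.exp (-(β / 2) * ((T *ᵥ φ + w) ⬝ᵥ (T *ᵥ φ + w))) : ℂ) *
        cexp (I * ((T *ᵥ φ + w) ⬝ᵥ σ : ℝ)) =
      ((gaussZ (β • gram T)).toReal : ℂ) *
        (Real.exp (-(β / 2) * (perpPart T w ⬝ᵥ perpPart T w)) : ℂ) *
        cexp (I * (perpPart T w ⬝ᵥ σ : ℝ)) * cexp (-((exactEnergy T σ : ℝ) : ℂ) / (2 * β)) := by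
  have hP : (β • gram T).PosDef := hM.smul hβ
  -- shift the integration variable by `φ_w`
  rw [← integral_sub_right_eq_self (μ := volume) _ (exactPreimage T w)]
  -- rewrite the shifted integrand
  have hpt : ∀ ψ : ι → ℝ,
      (Real.exp (-(β / 2) * ((T *ᵥ (ψ - exactPreimage T w) + w) ⬝ᵥ (T *ᵥ (ψ - exactPreimage T w) + w))) : ℂ) *
          cexp (I * ((T *ᵥ (ψ - exactPreimage T w) + w) ⬝ᵥ σ : ℝ)) =
        ((Real.exp (-(β / 2) * (perpPart T w ⬝ᵥ perpPart T w)) : ℂ) * cexp (I * (perpPart T w ⬝ᵥ σ : ℝ))) *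
          ((Real.exp (-(ψ ⬝ᵥ (β • gram T) *ᵥ ψ) / 2) : ℂ) * cexp (I * ((Tᵀ *ᵥ σ) ⬝ᵥ ψ : ℝ))) := by
    intro ψ
    rw [mulVec_sub_exactPreimage_add, norm_sq_mulVec_add_perpPart T hM, add_dotProduct,
      mulVec_dotProduct_eq, dotProduct_comm ψ (Tᵀ *ᵥ σ), Matrix.smul_mulVec, dotProduct_smul,
      smul_eq_mul]
    simp only [Complex.ofReal_exp, ← Complex.exp_add]
    congr 1
    push_cast
    ring
  simp_rw [hpt]
  rw [integral_const_mul, integral_exp_quadratic_mul_cexp _ hP (Tᵀ *ᵥ σ), inv_smul_gram T hM hβ.ne',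
    Matrix.smul_mulVec, dotProduct_smul, smul_eq_mul, ← exactEnergy]
  have h2 : cexp (-(((β⁻¹ * exactEnergy T σ : ℝ)) : ℂ) / 2) = cexp (-((exactEnergy T σ : ℝ) : ℂ) / (2 * β)) := by
    congr 1
    push_cast
    field_simp
  rw [h2]
  ring

omit [DecidableEq ι] in
/-- The normalisation: `Z_{βM} = ∫ e^{-(β/2)‖Tφ‖²} dφ`. [folklore] -/
theorem integral_exp_neg_mul_norm_sq_mulVec (T : Matrix κ ι ℝ) {β : ℝ} :
    ∫ φ : ι → ℝ, Real.exp (-(β / 2) * ((T *ᵥ φ) ⬝ᵥ (T *ᵥ φ))) = (gaussZ (β • gram T)).toReal := by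
  rw [← integral_exp_quadratic]
  refine integral_congr_ae (Filter.Eventually.of_forall fun φ => ?_)
  dsimp only
  rw [mulVec_dotProduct_self, Matrix.smul_mulVec, dotProduct_smul, smul_eq_mul]
  congr 1
  ring

end LinearImage

end GaussianCoord

end Literature.Probability.LatticeModels
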